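import Literature.InformationTheory.QuantumCodes.CSSEquivalence
import Literature.InformationTheory.QuantumCodes.ErasureDecoding
import Literature.InformationTheory.QuantumCodes.SyndromeDecodingCSS
import HarnessLib

/-!
# Permutation equivalence of CSS codes preserves the noise functionals: erasure-uncorrectability and
# decoder-failure probabilities are invariants of `CSSCode.reindex`

Topic `Literature/InformationTheory/QuantumCodes` (venture QEC, LADDER-QEC rung Q5; qec-lit-2 gen 4). The tree's
`CSSEquivalence.lean` proves that re-indexing a CSS code along bijections of checks and qubits
(`CSSCode.reindex C eX eZ eQ`, Lin–Pryadko's permutation equivalence: «a permutation matrix `S` acting by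
`S H_X (u;v) = (SAS⁻¹, SBS⁻¹)(Su; Sv)` … scalar products and, in particular, the row orthogonality, are preserved
by this transformation») preserves `d^X`, `d^Z`, `k`. This file PROVES that it also preserves the Q5
quantities of one error type (`Z`-sector: detected by `H^X`, trivial set `rs H^Z`; the `X`-sector follows by
`CSSCode.swap`, `reindex_swap`):

* `isCorrectableErasure_reindex_iff` — an erasure pattern `Er ⊆ Q'` is correctable for the re-indexed code iff
  its pull-back `eQ⁻¹(Er) ⊆ Q` is correctable for `C` (`IsCorrectableErasure`, `ErasureDecoding.lean`);
* `uncorrectableProb_reindex` — the probability that an independent erasure of rate `y` is uncorrectable is the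
  same for `C.reindex eX eZ eQ` and `C` (the bijection `Er ↦ eQ⁻¹(Er)` preserves cardinalities, hence the
  independent law);
* `corrects_reindex_iff`, `zFailure_reindex` — a syndrome decoder `D` of `C` transported along the re-indexing,
  `s' ↦ D(s' ∘ eX) ∘ eQ⁻¹`, corrects `e` iff `D` corrects `e ∘ eQ`, so its failure probability under
  independent flips of rate `p` (the sum `Σ_{e : ¬Corrects} p^{|e|}(1-p)^{n-|e|}` of the census families) equals
  that of `D`.

Use (Summits side): a code whose `X ↔ Z` exchange is a re-indexing of itself (toric codes, bivariate-bicycle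
codes) has IDENTICAL `Z`- and `X`-sector erasure families and transports every `Z`-decoder to an `X`-decoder
with the same failure probability — the symmetry hypothesis of the threshold converses
(`CSSThresholdConverses.lean`: `erasure_threshold_le_half_of_symm`, `capacity_threshold_le_quarter_of_symm`).
All PROVED; no named fact; no definition (the transported decoder is written as a lambda).

## References

* [LinPryadko2024] H.-K. Lin, L. P. Pryadko, *Quantum two-block group algebra codes*, Phys. Rev. A 109 (2024)
  022407 = arXiv:2306.16400, §4.2 Thm 6 and App. proof of (i) (chunk p0009 L66–74, p0018 L3–14) — permutation
  equivalence; tree: `CSSEquivalence.lean`.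
* [DelfosseZemor2020] N. Delfosse, G. Zémor, PRR 2 (2020) 033042, §2 (erasure decoding task; tree:
  `ErasureDecoding.lean`).
* [DennisEtAl2002] E. Dennis et al., J. Math. Phys. 43 (2002) 4452, §4.4 eq. (prob_E) (independent law).
-/

namespace Literature.InformationTheory.QuantumCodes

open Finset Matrix

namespace CSSCode

variable {RX RZ Q RX' RZ' Q' : Type*} [Fintype Q] [Fintype Q']

/-- Support of a pulled-back vector: `supp (v ∘ eQ) = eQ⁻¹(supp v)`.
[cite: LinPryadko2024, App. proof of Thm 6(i) (arXiv:2306.16400 chunk p0018 L6–14)] -/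
theorem supp_comp_equiv (eQ : Q ≃ Q') (v : Q' → ZMod 2) :
    supp (v ∘ eQ) = (supp v).map eQ.symm.toEmbedding := by
  ext q
  simp [supp, Finset.mem_map_equiv]

omit [Fintype Q] [Fintype Q'] in
/-- `eQ(eQ⁻¹(Er)) = Er`. [cite: LinPryadko2024, §4.2 Thm 6 (arXiv:2306.16400 chunk p0009 L66–74)] -/
theorem map_symm_map (eQ : Q ≃ Q') (Er : Finset Q') :
    (Er.map eQ.symm.toEmbedding).map eQ.toEmbedding = Er := by
  ext q
  simp [Finset.mem_map_equiv]

omit [Fintype Q] [Fintype Q'] in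
/-- `eQ⁻¹(eQ(Er)) = Er`. [cite: LinPryadko2024, §4.2 Thm 6 (arXiv:2306.16400 chunk p0009 L66–74)] -/
theorem map_map_symm (eQ : Q ≃ Q') (Er : Finset Q) :
    (Er.map eQ.toEmbedding).map eQ.symm.toEmbedding = Er := by
  ext q
  simp [Finset.mem_map_equiv]

/-! ### Erasures -/

/-- **Correctable erasures correspond under re-indexing**: `Er ⊆ Q'` is correctable for the `Z`-sector of
`C.reindex eX eZ eQ` iff `eQ⁻¹(Er)` is correctable for the `Z`-sector of `C` (the bijection `v ↦ v ∘ eQ`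
carries `ker H'^X` onto `ker H^X`, `rs H'^Z` onto `rs H^Z`, and supports onto pulled-back supports).
[cite: LinPryadko2024, §4.2 Thm 6 and App. proof of (i) (arXiv:2306.16400 chunk p0018 L6–14)] -/
theorem isCorrectableErasure_reindex_iff [Fintype RZ] [Fintype RZ'] (C : CSSCode RX RZ Q) (eX : RX ≃ RX')
    (eZ : RZ ≃ RZ') (eQ : Q ≃ Q') (Er : Finset Q') :
    IsCorrectableErasure {x | (C.reindex eX eZ eQ).HX *ᵥ x = 0}
        ((C.reindex eX eZ eQ).rowSpZ : Set (Q' → ZMod 2)) Er ↔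
      IsCorrectableErasure {x | C.HX *ᵥ x = 0} (C.rowSpZ : Set (Q → ZMod 2))
        (Er.map eQ.symm.toEmbedding) := by
  constructor
  · intro h x hx hxE
    have hv : (x ∘ eQ.symm) ∘ eQ = x := by
      funext q; simp
    have h1 : (C.reindex eX eZ eQ).HX *ᵥ (x ∘ eQ.symm) = 0 := by
      rw [reindex_HX_mulVec_eq_zero_iff, hv]
      exact hx
    have h2 : supp (x ∘ ⇑eQ.symm) ⊆ Er := by
      have h' := supp_comp_equiv eQ.symm x
      rw [Equiv.symm_symm] at h'
      rw [h', ← map_symm_map eQ Er]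
      exact Finset.map_subset_map.2 hxE
    have h3 : x ∘ ⇑eQ.symm ∈ (C.reindex eX eZ eQ).rowSpZ := h _ h1 h2
    rw [mem_rowSpZ_reindex_iff, hv] at h3
    exact h3
  · intro h v hv hvE
    have h1 : C.HX *ᵥ (v ∘ eQ) = 0 := (reindex_HX_mulVec_eq_zero_iff C eX eZ eQ v).1 hv
    have h2 : supp (v ∘ eQ) ⊆ Er.map eQ.symm.toEmbedding := by
      rw [supp_comp_equiv]
      exact Finset.map_subset_map.2 hvE
    have h3 : v ∘ ⇑eQ ∈ C.rowSpZ := h _ h1 h2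
    exact (mem_rowSpZ_reindex_iff C eX eZ eQ v).2 h3

/-- **The erasure-uncorrectability probability is a permutation invariant**: under independent erasures of
rate `y`, `P[uncorrectable]` is the same for the `Z`-sector of `C.reindex eX eZ eQ` and of `C`.
[cite: LinPryadko2024, §4.2 Thm 6 (permutation-equivalent codes) with DennisEtAl2002 §4.4 eq. (prob_E)] -/
theorem uncorrectableProb_reindex [Fintype RZ] [Fintype RZ'] [DecidableEq Q] [DecidableEq Q'] (C : CSSCode RX RZ Q) (eX : RX ≃ RX')
    (eZ : RZ ≃ RZ') (eQ : Q ≃ Q') (y : ℝ) :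
    ErasureDecoder.uncorrectableProb {x | (C.reindex eX eZ eQ).HX *ᵥ x = 0}
        ((C.reindex eX eZ eQ).rowSpZ : Set (Q' → ZMod 2)) y =
      ErasureDecoder.uncorrectableProb {x | C.HX *ᵥ x = 0} (C.rowSpZ : Set (Q → ZMod 2)) y := by
  classical
  rw [ErasureDecoder.uncorrectableProb_eq_sum, ErasureDecoder.uncorrectableProb_eq_sum]
  refine Finset.sum_nbij' (fun Er => Er.map eQ.symm.toEmbedding) (fun Er => Er.map eQ.toEmbedding)
    ?_ ?_ (fun Er _ => map_symm_map eQ Er) (fun Er _ => map_map_symm eQ Er) ?_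
  · intro Er hEr
    rw [mem_filter] at hEr ⊢
    exact ⟨mem_univ _, fun h => hEr.2 ((C.isCorrectableErasure_reindex_iff eX eZ eQ Er).2 h)⟩
  · intro Er hEr
    rw [mem_filter] at hEr ⊢
    refine ⟨mem_univ _, fun h => hEr.2 ?_⟩
    have h' := (C.isCorrectableErasure_reindex_iff eX eZ eQ (Er.map eQ.toEmbedding)).1 h
    rwa [map_map_symm] at h'
  · intro Er _
    rw [bernoulliWeight, bernoulliWeight, Finset.card_map, Fintype.card_congr eQ]

/-! ### Decoders -/

/-- The syndrome of the re-indexed code, pulled back along `eX`, is the syndrome of the pulled-back error: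
`(H'^X e) ∘ eX = H^X (e ∘ eQ)`. [cite: LinPryadko2024, App. proof of Thm 6(i) (arXiv:2306.16400 chunk p0018 L6–14)] -/
theorem reindex_zSyndrome_comp (C : CSSCode RX RZ Q) (eX : RX ≃ RX') (eZ : RZ ≃ RZ') (eQ : Q ≃ Q')
    (e : Q' → ZMod 2) : (C.reindex eX eZ eQ).zSyndrome e ∘ eX = C.zSyndrome (e ∘ eQ) := by
  change (Matrix.reindex eX eQ C.HX *ᵥ e) ∘ eX = C.HX *ᵥ (e ∘ eQ)
  rw [Matrix.reindex_apply, Matrix.submatrix_mulVec_equiv, Equiv.symm_symm]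
  funext r
  simp

/-- **Transported decoders correct corresponding errors.** The decoder `s' ↦ D(s' ∘ eX) ∘ eQ⁻¹` of the
re-indexed code corrects `e` iff `D` corrects `e ∘ eQ` (degenerate corrections included: `Decoder.Corrects`
tests membership of the net error in `rs H^Z`). [cite: LinPryadko2024, §4.2 Thm 6 and App. proof of (i) (arXiv:2306.16400 chunk p0018 L6–14)] -/
theorem corrects_reindex_iff [Fintype RZ] [Fintype RZ'] (C : CSSCode RX RZ Q) (eX : RX ≃ RX')
    (eZ : RZ ≃ RZ') (eQ : Q ≃ Q') (D : Decoder (RX → ZMod 2) (Q → ZMod 2)) (e : Q' → ZMod 2) :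
    Decoder.Corrects (fun s' : RX' → ZMod 2 => D (s' ∘ eX) ∘ eQ.symm) (C.reindex eX eZ eQ).zSyndrome
        ((C.reindex eX eZ eQ).rowSpZ : Set (Q' → ZMod 2)) e ↔
      D.Corrects C.zSyndrome (C.rowSpZ : Set (Q → ZMod 2)) (e ∘ eQ) := by
  have hcomp : (D ((C.reindex eX eZ eQ).zSyndrome e ∘ eX) ∘ ⇑eQ.symm + e) ∘ ⇑eQ =
      D (C.zSyndrome (e ∘ eQ)) + e ∘ eQ := by
    rw [reindex_zSyndrome_comp]
    funext q
    simp
  change (D ((C.reindex eX eZ eQ).zSyndrome e ∘ eX) ∘ ⇑eQ.symm + e ∈ (C.reindex eX eZ eQ).rowSpZ) ↔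
    (D (C.zSyndrome (e ∘ eQ)) + e ∘ eQ ∈ C.rowSpZ)
  rw [mem_rowSpZ_reindex_iff, hcomp]

open Classical in
/-- **The decoder-failure probability is a permutation invariant**: under independent flips of rate `p`, the
transported decoder `s' ↦ D(s' ∘ eX) ∘ eQ⁻¹` of `C.reindex eX eZ eQ` fails with exactly the probability with
which `D` fails on `C` (reindex the sum along the weight-preserving bijection `e ↦ e ∘ eQ`).
[cite: LinPryadko2024, §4.2 Thm 6 (permutation-equivalent codes) with DennisEtAl2002 §4.4 eq. (prob_E)] -/
theorem zFailure_reindex [Fintype RZ] [Fintype RZ'] [DecidableEq Q] [DecidableEq Q'] (C : CSSCode RX RZ Q) (eX : RX ≃ RX') (eZ : RZ ≃ RZ')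
    (eQ : Q ≃ Q') (D : Decoder (RX → ZMod 2) (Q → ZMod 2)) (p : ℝ) :
    (∑ e ∈ univ.filter (fun e : Q' → ZMod 2 =>
        ¬ Decoder.Corrects (fun s' : RX' → ZMod 2 => D (s' ∘ eX) ∘ eQ.symm) (C.reindex eX eZ eQ).zSyndrome
          ((C.reindex eX eZ eQ).rowSpZ : Set (Q' → ZMod 2)) e), bernoulliWeight p (supp e)) =
      ∑ e ∈ univ.filter (fun e : Q → ZMod 2 => ¬ D.Corrects C.zSyndrome (C.rowSpZ : Set (Q → ZMod 2)) e),
        bernoulliWeight p (supp e) := by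
  refine Finset.sum_nbij' (fun e => e ∘ eQ) (fun e => e ∘ eQ.symm) ?_ ?_ ?_ ?_ ?_
  · intro e he
    rw [mem_filter] at he ⊢
    exact ⟨mem_univ _, fun hc => he.2 ((C.corrects_reindex_iff eX eZ eQ D e).2 hc)⟩
  · intro e he
    rw [mem_filter] at he ⊢
    refine ⟨mem_univ _, fun hc => he.2 ?_⟩
    have h' := (C.corrects_reindex_iff eX eZ eQ D (e ∘ eQ.symm)).1 hc
    have hcomp : (e ∘ ⇑eQ.symm) ∘ ⇑eQ = e := by
      funext q; simp
    rwa [hcomp] at h'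
  · intro e _
    funext q
    simp
  · intro e _
    funext q
    simp
  · intro e _
    rw [bernoulliWeight, bernoulliWeight, supp_comp_equiv, Finset.card_map, Fintype.card_congr eQ]

end CSSCode

end Literature.InformationTheory.QuantumCodes
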